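import Mathlib
import HarnessLib
import Summits.NavierStokesRegularity.NavierStokesRegularity.Theorems.PoloidalWindowDoorPoloidalWindowRigidityVerticalConvexity
import Summits.NavierStokesRegularity.NavierStokesRegularity.Theorems.PoloidalWindowDoorPoloidalWindowRigidityWeightedIBP
import Summits.NavierStokesRegularity.NavierStokesRegularity.Theorems.PoloidalWindowDoorPoloidalWindowRigidityHorizontalConvolution

/-!
# Theorem A, assembly modulo the frequency cut-off: every `ρ`-reverse-Poincaré kernel annihilates the slice field

Seat ns-poloidal-K2-p2 g6 (interim lead-of-record on crux K2 `PoloidalWindowRigidity` = stmt-NavierStokesRegularity-19708;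
line `mixed_type` v1; item stmt-20428 `LrcModEntire`).  File 5b of the Lean port of **Theorem A** of memo TH-ELLIPTIC-LIOUVILLE-g6
(semi-elliptic (TH) Liouville without slope bounds).  Files 1–3 and 5a (`…VerticalConvexity` p571291, `…WeightedIBP` p572071,
`…WeightedYoung` p573065, `…HorizontalConvolution`) are combined here into the ABSTRACT form of Theorem A: for a bounded `C²_b`
family `w(z,·)` on a finite-dimensional inner product space `E` (`dim E < 4`) solving the (TH) slice equation
`∂_z² w = −Λ(z) · div ∇ w(z,·)` off a nowhere-dense set of heights with `Λ ≥ 0`, `Λ(z₁) > 0`, and for ANY integrable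
kernel `φ` carrying a σ-uniform WEIGHTED REVERSE POINCARÉ INEQUALITY

  `∫ (g ⋆ φ)² ρ_σ ≤ C ∫ ‖∇(g ⋆ φ)‖² ρ_σ`   for all `σ ≥ 1` and all bounded `C¹` `g` with bounded gradient

(`⋆` = `hconv`, derivatives on `g`; `ρ_σ = weight σ`), the horizontal convolution vanishes identically:

* `hconv_eq_zero_of_reversePoincare` — **`(w(z,·) ⋆ φ)(x) = 0` for all `z, x`.**

Proof: apply the 1-D core `integral_sq_eq_zero_of_verticalConvexity` on the finite measure `ρ_σ dx` (`σ = max 1 (2(C+1))`) to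
`u(z,·) = w(z,·) ⋆ φ`: the `z`-derivatives fall on `w` (`hasDerivAt_hconv_param`), the horizontal ones too (`contDiff_two_hconv`,
`gradient_hconv`, `divergence_gradient_hconv`), so `u` solves the same equation (the coefficient `Λ(z)` is constant on planes); the
integration-by-parts inequality is `integral_mul_divGrad_mul_weight_le` with `δ = 2/σ`; the reverse inequality is the hypothesis; the
core gives `∫ u(z,·)² ρ_σ = 0`, hence `u ≡ 0` (`u` continuous, `ρ_σ > 0`).
What remains for Theorem A (File 4′, successor): the Schwartz kernels `φ = β_ε − β_N` carry the reverse inequality (Fourier side +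
`…WeightedYoung`), and `w ⋆ β_ε = w ⋆ β_N` for all `0 < ε < N` forces `∇ₕ w = 0`.
WHAT THIS IS NOT: not a claim about Navier–Stokes — a kinematic Liouville mechanism (bears_on LADDER-NS N0 via crux K2 = stmt-19708 /
item 20428: closes mixed_type `stub_semiElliptic` ∩ (TH) once File 4′ lands).
-/

-- the summit and its single sub-problem share the name (CONVENTIONS §1)
set_option linter.dupNamespace false

noncomputable section

namespace Summit.NavierStokesRegularity.NavierStokesRegularity.Theorems.PoloidalWindowDoorPoloidalWindowRigidityThmAAssembly

open Set Function Filter Topology MeasureTheory InnerProductSpace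
open scoped RealInnerProductSpace ENNReal
open Summit.NavierStokesRegularity.NavierStokesRegularity.Theorems.PoloidalWindowDoorPoloidalWindowRigidityVerticalConvexity
open Summit.NavierStokesRegularity.NavierStokesRegularity.Theorems.PoloidalWindowDoorPoloidalWindowRigidityWeightedIBP
open Summit.NavierStokesRegularity.NavierStokesRegularity.Theorems.PoloidalWindowDoorPoloidalWindowRigidityHorizontalConvolution

variable {E : Type*} [NormedAddCommGroup E] [InnerProductSpace ℝ E] [FiniteDimensional ℝ E]
  [MeasurableSpace E] [BorelSpace E]

/-! ### The weighted measure `ρ_σ dx` -/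

/-- The finite measure `ρ_σ dx`. -/
def weightMeasure (σ : ℝ) : Measure E := volume.withDensity fun x => ENNReal.ofReal (weight σ x)

/-- `ρ_σ dx` is finite (`dim E < 4`). -/
theorem isFiniteMeasure_weightMeasure {σ : ℝ} (hσ : 0 < σ) (hE : Module.finrank ℝ E < 4) :
    IsFiniteMeasure (weightMeasure (E := E) σ) :=
  isFiniteMeasure_withDensity_ofReal (integrable_weight hσ hE).hasFiniteIntegral

/-- Integration against `ρ_σ dx` is integration of `g · ρ_σ`. -/
theorem integral_weightMeasure (σ : ℝ) (g : E → ℝ) :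
    ∫ x, g x ∂(weightMeasure σ) = ∫ x, g x * weight σ x := by
  unfold weightMeasure
  rw [integral_withDensity_eq_integral_toReal_smul (continuous_weight.measurable.ennreal_ofReal)
    (Eventually.of_forall fun x => ENNReal.ofReal_lt_top)]
  refine integral_congr_ae (Eventually.of_forall fun x => ?_)
  show (ENNReal.ofReal (weight σ x)).toReal • g x = g x * weight σ x
  rw [ENNReal.toReal_ofReal (weight_pos σ x).le, smul_eq_mul, mul_comm]

/-! ### The abstract Theorem A -/

/-- **THEOREM A, modulo the frequency cut-off.**  Let `dim E < 4`; let `w, wz, wzz : ℝ → E → ℝ` with, for every height `z`: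
`w(z,·) ∈ C²` with `w, Dw, D²w, ∇w, D∇w, div∇w` bounded by `M`; `wz(z,·)`, `wzz(z,·)` continuous and bounded by `M`;
`∂_z w = wz`, `∂_z wz = wzz` pointwise, `z ↦ wzz(z,x)` continuous; the slice equation `wzz(z,x) = −Λ(z)·div∇w(z,·)(x)` for all
`z ∉ F` (`Fᶜ` dense), `Λ ≥ 0`, `Λ(z₁) > 0`, `z₁ ∉ F`.  Let `φ` be integrable and carry the σ-uniform weighted reverse
Poincaré inequality `∫ (g ⋆ φ)² ρ_σ ≤ C ∫ ‖∇(g ⋆ φ)‖² ρ_σ` (`σ ≥ 1`, `g ∈ C¹` with `g, Dg, ∇g` bounded).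
Then `(w(z,·) ⋆ φ)(x) = 0` for all `z, x`. [folklore] -/
theorem hconv_eq_zero_of_reversePoincare (hE : Module.finrank ℝ E < 4)
    (w wz wzz : ℝ → E → ℝ) (Λ : ℝ → ℝ) (F : Set ℝ) {M : ℝ} {z₁ : ℝ}
    (hw2 : ∀ z, ContDiff ℝ 2 (w z))
    (hb0 : ∀ z x, ‖w z x‖ ≤ M) (hb1 : ∀ z x, ‖fderiv ℝ (w z) x‖ ≤ M) (hb2 : ∀ z x, ‖fderiv ℝ (fderiv ℝ (w z)) x‖ ≤ M)
    (hg0 : ∀ z x, ‖gradient (w z) x‖ ≤ M) (hg1 : ∀ z x, ‖fderiv ℝ (gradient (w z)) x‖ ≤ M)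
    (hdiv : ∀ z x, |Literature.Analysis.FluidPDE.VectorCalculus.divergence (gradient (w z)) x| ≤ M)
    (hwzc : ∀ z, Continuous (wz z)) (hwzzc : ∀ z, Continuous (wzz z)) (hwzzcz : ∀ x, Continuous fun z => wzz z x)
    (hbz : ∀ z x, |wz z x| ≤ M) (hbzz : ∀ z x, |wzz z x| ≤ M)
    (hd1 : ∀ x z, HasDerivAt (fun s => w s x) (wz z x) z) (hd2 : ∀ x z, HasDerivAt (fun s => wz s x) (wzz z x) z)
    (hF : Dense Fᶜ) (hΛ : ∀ z, 0 ≤ Λ z) (hz₁ : z₁ ∉ F) (hΛ₁ : 0 < Λ z₁)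
    (heq : ∀ z, z ∉ F → ∀ x, wzz z x = -(Λ z) * Literature.Analysis.FluidPDE.VectorCalculus.divergence (gradient (w z)) x)
    {φ : E → ℝ} (hφi : Integrable φ) {C : ℝ}
    (hrev : ∀ σ : ℝ, 1 ≤ σ → ∀ g : E → ℝ, ContDiff ℝ 1 g → (∃ K, ∀ x, ‖g x‖ ≤ K ∧ ‖fderiv ℝ g x‖ ≤ K ∧ ‖gradient g x‖ ≤ K) →
      ∫ x, (hconv g φ x) ^ 2 * weight σ x ≤ C * ∫ x, ‖gradient (hconv g φ) x‖ ^ 2 * weight σ x) :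
    ∀ z x, hconv (w z) φ x = 0 := by
  haveI : CompleteSpace E := FiniteDimensional.complete ℝ E
  -- constants
  set σ : ℝ := max 1 (2 * (C + 1)) with hσdef
  have hσ1 : 1 ≤ σ := le_max_left _ _
  have hσ0 : 0 < σ := lt_of_lt_of_le one_pos hσ1
  set δ : ℝ := 2 / σ with hδdef
  have hδ : 0 ≤ δ := by positivity
  have hδC : δ * (C + 1) ≤ 1 := by
    rw [hδdef, div_mul_eq_mul_div, div_le_one hσ0]
    exact le_max_right _ _
  haveI : IsFiniteMeasure (weightMeasure (E := E) σ) := isFiniteMeasure_weightMeasure hσ0 hE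
  set L1 : ℝ := ∫ y, |φ y| with hL1
  have hL1 : 0 ≤ L1 := integral_nonneg fun y => abs_nonneg _
  have hM : 0 ≤ M := by
    by_cases hEn : Nonempty E
    · exact (norm_nonneg _).trans (hb0 0 hEn.some)
    · exact (norm_nonneg _).trans (hb0 0 (0 : E))
  -- the five families of File 1
  set u : ℝ → E → ℝ := fun z => hconv (w z) φ with hu
  set uz : ℝ → E → ℝ := fun z => hconv (wz z) φ with huz
  set uzz : ℝ → E → ℝ := fun z => hconv (wzz z) φ with huzz
  set lap : ℝ → E → ℝ := fun z x => Literature.Analysis.FluidPDE.VectorCalculus.divergence (gradient (u z)) x with hlap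
  set g : ℝ → E → ℝ := fun z x => ‖gradient (u z) x‖ with hgdef
  -- regularity of `u z`
  have hw1 : ∀ z, ContDiff ℝ 1 (w z) := fun z => (hw2 z).of_le (by norm_num)
  have hu2 : ∀ z, ContDiff ℝ 2 (u z) := fun z => contDiff_two_hconv (hw2 z) (hb0 z) (hb1 z) (hb2 z) hφi
  have hgrad : ∀ z x, gradient (u z) x = hconv (gradient (w z)) φ x := fun z x =>
    gradient_hconv (hw1 z) (hb0 z) (hb1 z) (hg0 z) hφi x
  have hlap_eq : ∀ z x, lap z x = hconv (fun y => Literature.Analysis.FluidPDE.VectorCalculus.divergence (gradient (w z)) y) φ x := fun z x =>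
    divergence_gradient_hconv (hw2 z) (hb0 z) (hb1 z) (hg0 z) (hg1 z) hφi x
  -- continuity (for measurability)
  have hwc : ∀ z, Continuous (w z) := fun z => (hw2 z).continuous
  have hgwc : ∀ z, Continuous (gradient (w z)) := fun z =>
    (toDual ℝ E).symm.continuous.comp ((hw1 z).continuous_fderiv one_ne_zero)
  have hdivc : ∀ z, Continuous (fun y => Literature.Analysis.FluidPDE.VectorCalculus.divergence (gradient (w z)) y) := by
    intro z
    have hgc : ContDiff ℝ 1 (gradient (w z)) := by
      have e1 : gradient (w z) = fun y => (toDual ℝ E).symm (fderiv ℝ (w z) y) := rfl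
      rw [e1]
      exact (toDual ℝ E).symm.toContinuousLinearEquiv.contDiff.comp ((hw2 z).fderiv_right (m := 1) (by norm_num))
    simp only [divergence_eq_traceCLM]
    exact traceCLM.continuous.comp (hgc.continuous_fderiv one_ne_zero)
  have huc : ∀ z, Continuous (u z) := fun z => continuous_hconv (hwc z) (hb0 z) hφi
  have huzc : ∀ z, Continuous (uz z) := fun z => continuous_hconv (hwzc z) (fun x => by
    rw [Real.norm_eq_abs]; exact hbz z x) hφi
  have huzzc : ∀ z, Continuous (uzz z) := fun z => continuous_hconv (hwzzc z) (fun x => by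
    rw [Real.norm_eq_abs]; exact hbzz z x) hφi
  have hgc : ∀ z, Continuous (g z) := by
    intro z
    have : g z = fun x => ‖hconv (gradient (w z)) φ x‖ := funext fun x => by simp only [hgdef, hgrad]
    rw [this]
    exact (continuous_hconv (hgwc z) (hg0 z) hφi).norm
  have hlapc : ∀ z, Continuous (lap z) := by
    intro z
    have : lap z = hconv (fun y => Literature.Analysis.FluidPDE.VectorCalculus.divergence (gradient (w z)) y) φ := funext (hlap_eq z)
    rw [this]
    exact continuous_hconv (hdivc z) (fun x => by rw [Real.norm_eq_abs]; exact hdiv z x) hφi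
  -- bounds by `M * L1`
  have hbu : ∀ z x, |u z x| ≤ M * L1 := fun z x => by
    rw [← Real.norm_eq_abs]; exact norm_hconv_le (hb0 z) hφi x
  have hbuz : ∀ z x, |uz z x| ≤ M * L1 := fun z x => by
    rw [← Real.norm_eq_abs]
    exact norm_hconv_le (fun y => by rw [Real.norm_eq_abs]; exact hbz z y) hφi x
  have hbuzz : ∀ z x, |uzz z x| ≤ M * L1 := fun z x => by
    rw [← Real.norm_eq_abs]
    exact norm_hconv_le (fun y => by rw [Real.norm_eq_abs]; exact hbzz z y) hφi x
  have hbg : ∀ z x, |g z x| ≤ M * L1 := fun z x => by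
    simp only [hgdef, abs_norm, hgrad]
    exact norm_hconv_le (hg0 z) hφi x
  have hblap : ∀ z x, |lap z x| ≤ M * L1 := fun z x => by
    rw [hlap_eq, ← Real.norm_eq_abs]
    exact norm_hconv_le (fun y => by rw [Real.norm_eq_abs]; exact hdiv z y) hφi x
  -- `z`-derivatives and continuity in `z`
  have hud1 : ∀ x z, HasDerivAt (fun s => u s x) (uz z x) z := fun x z =>
    hasDerivAt_hconv_param hwc hwzc (fun z x => by rw [← Real.norm_eq_abs]; exact hb0 z x) hbz hd1 hφi x z
  have hud2 : ∀ x z, HasDerivAt (fun s => uz s x) (uzz z x) z := fun x z =>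
    hasDerivAt_hconv_param hwzc hwzzc hbz hbzz hd2 hφi x z
  have huzz_cz : ∀ x, Continuous fun z => uzz z x := by
    intro x
    simp only [huzz, hconv, smul_eq_mul]
    exact continuous_of_dominated
      (fun z => (hφi.aestronglyMeasurable.mul ((hwzzc z).comp (continuous_const.sub continuous_id)).aestronglyMeasurable))
      (fun z => Eventually.of_forall fun y => by
        rw [Real.norm_eq_abs, abs_mul, mul_comm]; exact mul_le_mul_of_nonneg_right (hbzz z _) (abs_nonneg _))
      (hφi.abs.const_mul M) (Eventually.of_forall fun y => continuous_const.mul ((hwzzcz (x - y))))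
  -- the equation for `u`
  have hequ : ∀ z, z ∉ F → ∀ x, uzz z x = -(Λ z) * lap z x := by
    intro z hz x
    rw [hlap_eq]
    simp only [huzz, hconv, smul_eq_mul]
    rw [← integral_const_mul]
    refine integral_congr_ae (Eventually.of_forall fun y => ?_)
    show φ y * wzz z (x - y) = -(Λ z) * (φ y * Literature.Analysis.FluidPDE.VectorCalculus.divergence (gradient (w z)) (x - y))
    rw [heq z hz (x - y)]
    ring
  -- the weighted IBP inequality (File 2) and the reverse inequality (hypothesis), moved to the weighted measure
  have hibp' : ∀ z, ∫ x, u z x * lap z x ∂(weightMeasure σ) ≤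
      -(∫ x, g z x ^ 2 ∂(weightMeasure σ)) + δ * ∫ x, |u z x| * |g z x| ∂(weightMeasure σ) := by
    intro z
    rw [integral_weightMeasure, integral_weightMeasure, integral_weightMeasure]
    have h := integral_mul_divGrad_mul_weight_le hσ0 hE (hu2 z) (K := M * L1) (fun x => hbu z x)
      (fun x => by have := hbg z x; rwa [hgdef, abs_norm] at this) (fun x => hblap z x)
    simp only [hlap, hgdef, abs_norm]
    exact h
  have hrev' : ∀ z, ∫ x, u z x ^ 2 ∂(weightMeasure σ) ≤ C * ∫ x, g z x ^ 2 ∂(weightMeasure σ) := by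
    intro z
    rw [integral_weightMeasure, integral_weightMeasure]
    exact hrev σ hσ1 (w z) (hw1 z) ⟨M, fun x => ⟨hb0 z x, hb1 z x, hg0 z x⟩⟩
  -- apply the core
  have hcore := integral_sq_eq_zero_of_verticalConvexity (μ := weightMeasure (E := E) σ) u uz uzz lap g Λ F
    (C := C) (δ := δ) (M := M * L1) (z₁ := z₁)
    (fun z => (huc z).aestronglyMeasurable) (fun z => (huzc z).aestronglyMeasurable)
    (fun z => (huzzc z).aestronglyMeasurable) (fun z => (hlapc z).aestronglyMeasurable)
    (fun z => (hgc z).aestronglyMeasurable) hbu hbuz hbuzz hblap hbg hud1 hud2 huzz_cz hF hΛ hz₁ hΛ₁ hequ hibp' hrev' hδ hδC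
  -- `∫ u(z,·)² ρ_σ = 0` with `u(z,·)` continuous and `ρ_σ > 0` ⇒ `u(z,·) ≡ 0`
  intro z x
  have h0 : ∫ y, u z y ^ 2 * weight σ y = 0 := by rw [← integral_weightMeasure]; exact hcore z
  have hcont : Continuous fun y => u z y ^ 2 * weight σ y := ((huc z).pow 2).mul continuous_weight
  have hnn : ∀ y, 0 ≤ u z y ^ 2 * weight σ y := fun y => mul_nonneg (sq_nonneg _) (weight_pos σ y).le
  have hint : Integrable fun y => u z y ^ 2 * weight σ y :=
    integrable_of_le_weight hσ0 hE hcont (K := (M * L1) ^ 2) fun y => by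
      rw [abs_mul, abs_weight, abs_pow]
      exact mul_le_mul_of_nonneg_right (pow_le_pow_left₀ (abs_nonneg _) (hbu z y) 2) (weight_pos σ y).le
  have hae := (integral_eq_zero_iff_of_nonneg hnn hint).1 h0
  have hzero : (fun y => u z y ^ 2 * weight σ y) = 0 :=
    Continuous.ae_eq_iff_eq volume hcont continuous_const |>.1 hae
  have hx := congrFun hzero x
  simp only [Pi.zero_apply, mul_eq_zero, (weight_pos σ x).ne', or_false, pow_eq_zero_iff, ne_eq,
    OfNat.ofNat_ne_zero, not_false_eq_true] at hx
  exact hx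

end Summit.NavierStokesRegularity.NavierStokesRegularity.Theorems.PoloidalWindowDoorPoloidalWindowRigidityThmAAssembly
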